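import Summits.BirchSwinnertonDyer.Rank1Residual.P2.KrizLiTwoFortyThreeIsogenyClass
import HarnessLib

/-!
# Cell `bsd-print-cf2` (D-0131 (2) PRINT TIER, leaf CornerF @ `p = 2`), prover p3 — the Kriz–Li door
# made BASE-GENERIC and FIELD-GENERIC: `BSD(W,2)` on the quadratic-twist families of ANY CM base of
# conductor `< 5000`, over ANY Heegner field, granted the (★)-datum (inside the membership) and seven
# named facts

HONEST FRAMING. The leaf `Summit.BirchSwinnertonDyer.WAllCornerFTwo` (every CM `E/ℚ` of analytic rank one
satisfies Miller's `BSD(E,2)`) and crux `InertJZeroOfFacts` of route PrintCf2 (its `j = 0` piece) are OPEN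
AS CLASSES; nothing class-wide is closed here, no named fact is introduced, nothing is asserted. The p3 g2
files `P2/KrizLiTwoFortyThree{Curve,Slices,IsogenyClass}.lean` close the ONE printed instance of the
Kriz–Li door (base `243a1 = x³ + y³ = 9`, `K = ℚ(√−23)`, Assumption (★) = the printed Table-1 row). Kriz–Li
2019 Thm 5.1 (2) (`KrizLi2019.thm112_bsdTwo_twist`, conjunct of the crux bundle 𝔅_inert) is however stated
for ANY base `E` with `E(ℚ)[2] = 0`, ANY imaginary quadratic `K` with the Heegner hypothesis and `2` split,
and ANY Heegner point with (★) (lit g4 DOSSIER §14.6: "the Kriz–Li door is K-generic"; §14.4: eight further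
CM bases of conductor `< 5000` pass (★) at certificate level — among them the isogeny classes of the
Sylvester cube-sum curves `x³ + y³ = 13` (`4563b1`) and `x³ + y³ = 7²` (`1323a1`)). This file proves the
transport ONCE for all of them:

* §1 `bsdp_two_of_twist_of_krizLi_cmBase`: for a globally minimal CM base `W` with `N(W) < 5000`,
  `1 ≤ rank_ℤ W(ℚ)`, `E(ℚ)[2] = 0`, a Heegner field `K`, a parametrisation datum / Heegner datum / Heegner
  point with (★), `c₂(W)` odd (and odd Manin constant if additive at `2`), and `d ∈ 𝒩(W, K)` with
  `χ_d(−N) = 1`: every globally minimal model of `W^{(d)}` or `W^{(d·d_K)}` satisfies `BSD(·, 2)` — granted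
  BY NAME Kriz–Li Thm 5.1 (2) (`hKL`) and Thm 4.3 (`h33`), Creutz–Miller / Miller–Stoll (`hS31`: the base,
  `r_an ≤ 1`, `N < 5000`), Burungale–Flach 2024 (`hBF`: the rank-zero CM partner `W^{(d_K)}`, any conductor,
  and `r_an(W) ≠ 0` from the rational point of infinite order) and modularity (`hmod`). `r_an(W) = 1` is
  DERIVED (Thm 4.3 at `d = 1` gives `≤ 1`). §2 adds Cassels (`hCassels`) and GZK (`hGZK`) for the
  `ℚ`-isogeny classes.
* (companion file `P2/KrizLiSmallCMBase.lean`) the membership predicate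
  `IsIsogenousToKrizLiTwistOfSmallCMBase W'` (an `∃` over the base, the field, the (★)-datum and `d`) and
  the slice BY NAME in the binder shapes of the leaf and of crux 20671, from seven binders `hKL h33 hS31 hBF
  hmod hGZK hCassels` (five in 𝔅_inert, two = asides 20767 / 20768) with NO table fact; and the printed
  instance as a member (`IsIsogenousToKrizLiTwoFortyThreeTwist W' → table1_row243a1 → …`).

Currency: for a member exhibited through a CERTIFIED (not printed) (★)-datum the closure is
LITERAL-by-name((★)-display); for the `243a1` fibre it is the Table-1 row (print). Beyond print: NO as a
method (the theorem is Kriz–Li's); as COVERAGE, every (★)-certificate at a CM base of conductor `< 5000`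
(lit §14.4: nine bases; §14.6: 118 (base, field) pairs with `|d_K| ≤ 800`) now closes its twist family by
ONE theorem call. What is NOT reached: any cube-sum curve `x³ + y³ = n` other than the bases themselves
(the `C_n` are CUBIC twists; `𝒩 ∌ −3`), i.e. the Sylvester family stays OPEN at `2` as a class
(Cai–Shu–Tian 2017 / Hu–Shu–Yin 2019 exclude `ℓ = 2`; Kezuka–Li 2020 is `Ш[2]` only); and no base of
conductor `≥ 5000` (Kriz–Li take `BSD(E,2)` of the base as INPUT: arXiv:1606.03172 §4.2 Cor. 4.2 /
§5.3 — (★) does not give `Ш(E/K)[2] = 0`, their Remark after Lemma 4.6).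

References: [KrizLi2019] Thm 5.1 (2) (FMS VoR p. 30), Thm 4.3 (p. 28), Def 4.1, Rem 5.2, §6 Ex. 6.2, Table 1,
Rem 6.3; arXiv:1606.03172 §4.1–§5.3 (pp. 16–18 of the hub text); [CreutzMiller2012] Thm 1.1;
[MillerStoll2012] Thm 9.1; [BurungaleFlach2024] Thm 1.1, Cor 2; [MilneADT2006] I.7.3; [SilvermanAEC2009]
VII.3.4, X.5.4, C.11; tree `P2/TransportAtTwo.lean` (`bsdp_two_twists_of_krizLi`), `P2/KrizLiTwoFortyThree*`.
-/

noncomputable section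

open scoped Classical

open WeierstrassCurve NumberField Literature.NumberTheory.EllipticCurves
  Literature.NumberTheory.EllipticCurves.Rank1Residual
  Literature.NumberTheory.EllipticCurves.ModularForms
  Summit.BirchSwinnertonDyer.Rank1Residual

set_option autoImplicit false

namespace Summit.BirchSwinnertonDyer.Rank1Residual.P2

/-! ## §1 The transport from a small-conductor CM base (base-generic, field-generic) -/

/-- **CM is inherited by every `ℚ`-model of every quadratic twist** (`j` is a twist invariant and `HasCM`
depends only on `j`). [cite: SilvermanAEC2009, X.5 Cor. 5.4 and App. C §11] -/
theorem hasCM_of_smul_twist_of_hasCM {W : WeierstrassCurve ℚ} [W.IsElliptic] (hcm : W.HasCM) {d : ℚ}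
    (hd : d ≠ 0) {W' : WeierstrassCurve ℚ} [W'.IsElliptic]
    (hW' : ∃ C : VariableChange ℚ, C • W.quadraticTwist d = W') : W'.HasCM := by
  obtain ⟨C, hC⟩ := hW'
  haveI : (W.quadraticTwist d).IsElliptic := W.isElliptic_quadraticTwist hd
  subst hC
  have hj : (C • W.quadraticTwist d).j = W.j := by rw [variableChange_j, W.j_quadraticTwist hd]
  exact (WeierstrassCurve.hasCM_iff_of_j_eq hj).mpr hcm

/-- **`ord_{s=1} L(W, s) ≠ 0` for a CM curve with a rational point of infinite order**, granted the CM
rank-zero row C8 (`hBF`, Burungale–Flach 2024 / Rubin: `L(E,1) ≠ 0 ⇒ rank_ℤ E(ℚ) = 0`) and modularity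
(`hmod`, to read `r_an = 0` as `L(E,1) ≠ 0`). [cite: BurungaleFlach2024, Thm. 1.1 and Cor. 2] -/
theorem analyticRank_ne_zero_of_hasCM_of_one_le_rank (hBF : bsdTriple_of_hasCM_of_L_one_ne_zero)
    (hmod : hasEntireLFunction_rat) (W : WeierstrassCurve ℚ) [W.IsElliptic] [W.IsGloballyMinimal]
    (hcm : W.HasCM) (hrk : 1 ≤ W.mordellWeilRank) : W.analyticRank ≠ 0 := by
  intro h0
  have hL : W.entireLFunction 1 ≠ 0 := (W.analyticRank_eq_zero_iff_holds (hmod W)).mp h0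
  have hr : W.analyticRank = W.mordellWeilRank := (hBF W hcm hL).1
  omega

section Base

variable (W : WeierstrassCurve ℚ) [W.IsElliptic] [W.IsGloballyMinimal] [NeZero (W.conductorNorm ℤ)]

/-- **Kriz–Li Thm 4.3 at `d = 1`** (`1 ∈ 𝒩` is the empty product, `χ_1(−N) = 1`): for globally minimal
models `W₁` of `W^{(1)}` and `W₀` of `W^{(d_K)}`, `{r_an(W₁), r_an(W₀)} = {0, 1}` and `r_an(W₁) = r_an(W)`.
Base-generic and field-generic. [cite: KrizLi2019, Thm. 4.3 (FMS) = arXiv:1606.03172 Thm. 3.3] -/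
theorem analyticRank_dichotomy_of_assumptionStar (h33 : KrizLi2019.thm33_rank_twist)
    (h2 : ∀ Q : W.toAffine.Point, 2 • Q = 0 → Q = 0)
    (K : Type) [Field K] [NumberField K] (hK : IsImaginaryQuadratic K)
    (hH : SatisfiesHeegnerHypothesis (W.conductorNorm ℤ) K)
    (Dt : ModularParametrizationData W (W.conductorNorm ℤ))
    (H : HeegnerDatum (W.conductorNorm ℤ) (NumberField.discr K)) (ι : K →+* ℂ)
    (P : (W.baseChange K).toAffine.Point)
    (hP : WeierstrassCurve.Affine.Point.map ι.toRatAlgHom P = heegnerPointComplex Dt H)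
    (j : K →ₐ[ℚ] ℚ_[2]) (hstar : KrizLi2019.AssumptionStar W Dt K P j)
    (W₁ W₀ : WeierstrassCurve ℚ) [W₁.IsElliptic] [W₁.IsGloballyMinimal] [W₀.IsElliptic]
    [W₀.IsGloballyMinimal] (hW₁ : ∃ C : VariableChange ℚ, C • W.quadraticTwist 1 = W₁)
    (hW₀ : ∃ C : VariableChange ℚ, C • W.quadraticTwist (NumberField.discr K : ℚ) = W₀) :
    ((W₁.analyticRank = 1 ∧ W₀.analyticRank = 0) ∨ (W₁.analyticRank = 0 ∧ W₀.analyticRank = 1)) ∧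
      W₁.analyticRank = W.analyticRank := by
  have hW₁' : ∃ C : VariableChange ℚ, C • W₁ = W.quadraticTwist ((1 : ℤ) : ℚ) := by
    push_cast; exact exists_smul_eq_comm.2 hW₁
  have hW₀' : ∃ C : VariableChange ℚ,
      C • W₀ = W.quadraticTwist ((1 * NumberField.discr K : ℤ) : ℚ) := by
    rw [one_mul]; exact exists_smul_eq_comm.2 hW₀
  obtain ⟨-, -, hor, hiff⟩ := h33 W h2 K hK hH Dt H ι P hP j hstar 1 (KrizLi2019.inN_one _ _)
    W₁ W₀ hW₁' hW₀'
  exact ⟨hor, hiff.2 (by rw [Int.sign_one, one_mul]; exact jacobiSym.one_right _)⟩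

/-- **`ord_{s=1} L(W, s) = 1` for a CM base with a rational point of infinite order and a (★)-datum**:
Thm 4.3 at `d = 1` gives `≤ 1` (`h33`), the point with Burungale–Flach (`hBF`) and modularity (`hmod`)
gives `≠ 0`. [cite: KrizLi2019, Thm. 4.3 (FMS)] [cite: BurungaleFlach2024, Cor. 2] -/
theorem analyticRank_eq_one_of_assumptionStar (h33 : KrizLi2019.thm33_rank_twist)
    (hBF : bsdTriple_of_hasCM_of_L_one_ne_zero) (hmod : hasEntireLFunction_rat)
    (hcm : W.HasCM) (hrk : 1 ≤ W.mordellWeilRank) (h2 : ∀ Q : W.toAffine.Point, 2 • Q = 0 → Q = 0)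
    (K : Type) [Field K] [NumberField K] (hK : IsImaginaryQuadratic K)
    (hH : SatisfiesHeegnerHypothesis (W.conductorNorm ℤ) K)
    (Dt : ModularParametrizationData W (W.conductorNorm ℤ))
    (H : HeegnerDatum (W.conductorNorm ℤ) (NumberField.discr K)) (ι : K →+* ℂ)
    (P : (W.baseChange K).toAffine.Point)
    (hP : WeierstrassCurve.Affine.Point.map ι.toRatAlgHom P = heegnerPointComplex Dt H)
    (j : K →ₐ[ℚ] ℚ_[2]) (hstar : KrizLi2019.AssumptionStar W Dt K P j) : W.analyticRank = 1 := by
  obtain ⟨W₁, _, _, hW₁⟩ := exists_globallyMinimal_twist W (d := (1 : ℚ)) one_ne_zero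
  have hD : (NumberField.discr K : ℚ) ≠ 0 := by exact_mod_cast NumberField.discr_ne_zero K
  obtain ⟨W₀, _, _, hW₀⟩ := exists_globallyMinimal_twist W hD
  obtain ⟨hor, heq⟩ :=
    analyticRank_dichotomy_of_assumptionStar W h33 h2 K hK hH Dt H ι P hP j hstar W₁ W₀ hW₁ hW₀
  have hne := analyticRank_ne_zero_of_hasCM_of_one_le_rank hBF hmod W hcm hrk
  omega

/-- **`ord_{s=1} L(W^{(d_K)}, s) = 0`** on every globally minimal model of the partner twist (Thm 4.3 at
`d = 1` and the previous theorem). [cite: KrizLi2019, Thm. 4.3 (FMS)] -/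
theorem analyticRank_partner_eq_zero_of_assumptionStar (h33 : KrizLi2019.thm33_rank_twist)
    (hBF : bsdTriple_of_hasCM_of_L_one_ne_zero) (hmod : hasEntireLFunction_rat)
    (hcm : W.HasCM) (hrk : 1 ≤ W.mordellWeilRank) (h2 : ∀ Q : W.toAffine.Point, 2 • Q = 0 → Q = 0)
    (K : Type) [Field K] [NumberField K] (hK : IsImaginaryQuadratic K)
    (hH : SatisfiesHeegnerHypothesis (W.conductorNorm ℤ) K)
    (Dt : ModularParametrizationData W (W.conductorNorm ℤ))
    (H : HeegnerDatum (W.conductorNorm ℤ) (NumberField.discr K)) (ι : K →+* ℂ)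
    (P : (W.baseChange K).toAffine.Point)
    (hP : WeierstrassCurve.Affine.Point.map ι.toRatAlgHom P = heegnerPointComplex Dt H)
    (j : K →ₐ[ℚ] ℚ_[2]) (hstar : KrizLi2019.AssumptionStar W Dt K P j)
    (W₀ : WeierstrassCurve ℚ) [W₀.IsElliptic] [W₀.IsGloballyMinimal]
    (hW₀ : ∃ C : VariableChange ℚ, C • W.quadraticTwist (NumberField.discr K : ℚ) = W₀) :
    W₀.analyticRank = 0 := by
  obtain ⟨W₁, _, _, hW₁⟩ := exists_globallyMinimal_twist W (d := (1 : ℚ)) one_ne_zero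
  obtain ⟨hor, heq⟩ :=
    analyticRank_dichotomy_of_assumptionStar W h33 h2 K hK hH Dt H ι P hP j hstar W₁ W₀ hW₁ hW₀
  have h1 := analyticRank_eq_one_of_assumptionStar W h33 hBF hmod hcm hrk h2 K hK hH Dt H ι P hP j hstar
  omega

/-- **`BSD(W^{(d_K)}, 2)` — the rank-zero CM partner of the base, ANY conductor**: it has CM (twist of a
CM curve) and analytic rank `0`, so row C8 (Burungale–Flach 2024 Thm 1.1 + Cor 2, tree fact
`bsdTriple_of_hasCM_of_L_one_ne_zero`, every prime including `2`) applies — where Kriz–Li Rem 5.2 says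
"numerical verification". [cite: BurungaleFlach2024, Thm. 1.1 and Cor. 2 (p. 4)] [cite: KrizLi2019, Rem. 5.2] -/
theorem bsdp_two_partner_of_assumptionStar (h33 : KrizLi2019.thm33_rank_twist)
    (hBF : bsdTriple_of_hasCM_of_L_one_ne_zero) (hmod : hasEntireLFunction_rat)
    (hcm : W.HasCM) (hrk : 1 ≤ W.mordellWeilRank) (h2 : ∀ Q : W.toAffine.Point, 2 • Q = 0 → Q = 0)
    (K : Type) [Field K] [NumberField K] (hK : IsImaginaryQuadratic K)
    (hH : SatisfiesHeegnerHypothesis (W.conductorNorm ℤ) K)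
    (Dt : ModularParametrizationData W (W.conductorNorm ℤ))
    (H : HeegnerDatum (W.conductorNorm ℤ) (NumberField.discr K)) (ι : K →+* ℂ)
    (P : (W.baseChange K).toAffine.Point)
    (hP : WeierstrassCurve.Affine.Point.map ι.toRatAlgHom P = heegnerPointComplex Dt H)
    (j : K →ₐ[ℚ] ℚ_[2]) (hstar : KrizLi2019.AssumptionStar W Dt K P j)
    (W₀ : WeierstrassCurve ℚ) [W₀.IsElliptic] [W₀.IsGloballyMinimal]
    (hW₀ : ∃ C : VariableChange ℚ, C • W.quadraticTwist (NumberField.discr K : ℚ) = W₀) :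
    BSDp W₀ 2 := by
  have hD : (NumberField.discr K : ℚ) ≠ 0 := by exact_mod_cast NumberField.discr_ne_zero K
  exact RowC8.bsdp hBF hmod ⟨hasCM_of_smul_twist_of_hasCM hcm hD hW₀,
    analyticRank_partner_eq_zero_of_assumptionStar W h33 hBF hmod hcm hrk h2 K hK hH Dt H ι P hP j
      hstar W₀ hW₀⟩

/-- **`BSD(W, 2)` for the base itself** (`r_an(W) = 1`, `N(W) < 5000`: Creutz–Miller / Miller–Stoll, `hS31`).
[cite: CreutzMiller2012, Thm. 1.1] [cite: KrizLi2019, Rem. 5.2 (FMS)] -/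
theorem bsdp_two_base_of_assumptionStar (h33 : KrizLi2019.thm33_rank_twist)
    (hS31 : bsdTriple_of_analyticRank_le_one_of_conductor_lt)
    (hBF : bsdTriple_of_hasCM_of_L_one_ne_zero) (hmod : hasEntireLFunction_rat)
    (hcm : W.HasCM) (hN : W.conductorNorm ℤ < 5000) (hrk : 1 ≤ W.mordellWeilRank)
    (h2 : ∀ Q : W.toAffine.Point, 2 • Q = 0 → Q = 0)
    (K : Type) [Field K] [NumberField K] (hK : IsImaginaryQuadratic K)
    (hH : SatisfiesHeegnerHypothesis (W.conductorNorm ℤ) K)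
    (Dt : ModularParametrizationData W (W.conductorNorm ℤ))
    (H : HeegnerDatum (W.conductorNorm ℤ) (NumberField.discr K)) (ι : K →+* ℂ)
    (P : (W.baseChange K).toAffine.Point)
    (hP : WeierstrassCurve.Affine.Point.map ι.toRatAlgHom P = heegnerPointComplex Dt H)
    (j : K →ₐ[ℚ] ℚ_[2]) (hstar : KrizLi2019.AssumptionStar W Dt K P j) : BSDp W 2 :=
  bsdp_two_of_analyticRank_le_one_of_conductor_lt_5000 hS31 W
    (analyticRank_eq_one_of_assumptionStar W h33 hBF hmod hcm hrk h2 K hK hH Dt H ι P hP j hstar).le hN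

omit [W.IsElliptic] [NeZero (W.conductorNorm ℤ)] in
/-- `d ∈ 𝒩(W, K)` is non-zero (`|d|` is square-free). [folklore] -/
theorem cast_ne_zero_of_inN {K : Type} [Field K] [NumberField K] {d : ℤ} (hd : KrizLi2019.InN W K d) :
    (d : ℚ) ≠ 0 := by
  exact_mod_cast Int.natAbs_ne_zero.mp hd.2.1.ne_zero

/-- **THE TRANSPORT, BASE-GENERIC AND FIELD-GENERIC — `BSD(·, 2)` on the Kriz–Li twists of a
small-conductor CM base.** For a globally minimal CM base `W` with `N(W) < 5000`, a rational point of
infinite order (`1 ≤ rank_ℤ W(ℚ)`), `E(ℚ)[2] = 0`; an imaginary quadratic `K` with the Heegner hypothesis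
for `N(W)`; a parametrisation datum `Dt` (`Dt.c = c_E`), Heegner datum, embedding, Heegner point
`P ∈ W(K)` and `j : K → ℚ₂` with Assumption (★); `c₂(W)` odd and `Dt.c` odd if `W` is additive at `2`;
`d ∈ 𝒩(W, K)` with `χ_d(−N) = sgn(d)·(N/|d|) = 1`: EVERY globally minimal `ℚ`-model `W'` of `W^{(d)}` or of
`W^{(d·d_K)}` satisfies `BSD(W', 2)` — granted BY NAME Kriz–Li Thm 5.1 (2) (`hKL`) and Thm 4.3 (`h33`),
Creutz–Miller (`hS31`, the base), Burungale–Flach (`hBF`, the partner and `r_an(W) ≠ 0`) and modularity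
(`hmod`). Specialises to p3 g2's `bsdp_two_of_twist_curve243a1` at `(243a1, ℚ(√−23), Table-1 row)`.
[cite: KrizLi2019, Thm. 5.1 (2) (FMS, VoR p. 30) = arXiv:1606.03172 Thm. 1.12; Thm. 4.3; Rem. 5.2]
[cite: CreutzMiller2012, Thm. 1.1] [cite: BurungaleFlach2024, Thm. 1.1 and Cor. 2] [cite: Miller2011LMS, Def. 1.1] -/
theorem bsdp_two_of_twist_of_krizLi_cmBase (hKL : KrizLi2019.thm112_bsdTwo_twist)
    (h33 : KrizLi2019.thm33_rank_twist) (hS31 : bsdTriple_of_analyticRank_le_one_of_conductor_lt)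
    (hBF : bsdTriple_of_hasCM_of_L_one_ne_zero) (hmod : hasEntireLFunction_rat)
    (hcm : W.HasCM) (hN : W.conductorNorm ℤ < 5000) (hrk : 1 ≤ W.mordellWeilRank)
    (h2 : ∀ Q : W.toAffine.Point, 2 • Q = 0 → Q = 0)
    (K : Type) [Field K] [NumberField K] (hK : IsImaginaryQuadratic K)
    (hH : SatisfiesHeegnerHypothesis (W.conductorNorm ℤ) K)
    (Dt : ModularParametrizationData W (W.conductorNorm ℤ))
    (H : HeegnerDatum (W.conductorNorm ℤ) (NumberField.discr K)) (ι : K →+* ℂ)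
    (P : (W.baseChange K).toAffine.Point)
    (hP : WeierstrassCurve.Affine.Point.map ι.toRatAlgHom P = heegnerPointComplex Dt H)
    (j : K →ₐ[ℚ] ℚ_[2]) (hstar : KrizLi2019.AssumptionStar W Dt K P j)
    (hloc : (haveI : Fact (2 : ℕ).Prime := ⟨Nat.prime_two⟩;
      Odd ((W.baseChange ℚ_[2]).localTamagawaNumber ℤ_[2]) ∧
        (¬ W.HasGoodReductionAtPrime 2 → ¬ W.HasMultiplicativeReductionAtPrime 2 → Odd Dt.c)))
    {d : ℤ} (hd : KrizLi2019.InN W K d) (hsign : Int.sign d * jacobiSym (W.conductorNorm ℤ) d.natAbs = 1)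
    (W' : WeierstrassCurve ℚ) [W'.IsElliptic] [W'.IsGloballyMinimal]
    (hW' : (∃ C : VariableChange ℚ, C • W.quadraticTwist (d : ℚ) = W') ∨
      (∃ C : VariableChange ℚ, C • W.quadraticTwist ((d * NumberField.discr K : ℤ) : ℚ) = W')) :
    BSDp W' 2 := by
  have hD : (NumberField.discr K : ℚ) ≠ 0 := by exact_mod_cast NumberField.discr_ne_zero K
  obtain ⟨W₀, _, _, hW₀⟩ := exists_globallyMinimal_twist W hD
  have hbase : BSDp W 2 :=
    bsdp_two_base_of_assumptionStar W h33 hS31 hBF hmod hcm hN hrk h2 K hK hH Dt H ι P hP j hstar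
  have hbase₀ : BSDp W₀ 2 :=
    bsdp_two_partner_of_assumptionStar W h33 hBF hmod hcm hrk h2 K hK hH Dt H ι P hP j hstar W₀ hW₀
  have hd0 : (d : ℚ) ≠ 0 := cast_ne_zero_of_inN W hd
  have hdK : ((d * NumberField.discr K : ℤ) : ℚ) ≠ 0 := by push_cast; exact mul_ne_zero hd0 hD
  rcases hW' with hW' | hW'
  · obtain ⟨W₂, _, _, hW₂⟩ := exists_globallyMinimal_twist W hdK
    exact (bsdp_two_twists_of_krizLi hKL h2 K hK hH Dt H ι P hP j hstar hloc hW₀ hbase hbase₀ d hd hsign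
      (W₁ := W') (W₂ := W₂) hW' hW₂).1
  · obtain ⟨W₁, _, _, hW₁⟩ := exists_globallyMinimal_twist W hd0
    exact (bsdp_two_twists_of_krizLi hKL h2 K hK hH Dt H ι P hP j hstar hloc hW₀ hbase hbase₀ d hd hsign
      (W₁ := W₁) (W₂ := W') hW₁ hW').2

/-- **The analytic ranks along the family** (Thm 4.3 with `r_an(W) = 1`): for `d ∈ 𝒩` with `χ_d(−N) = 1`,
every globally minimal model of `W^{(d)}` has analytic rank `1` and every globally minimal model of
`W^{(d·d_K)}` has analytic rank `0`. [cite: KrizLi2019, Thm. 4.3 (FMS) = arXiv Thm. 3.3] -/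
theorem analyticRank_of_twist_of_krizLi_cmBase (h33 : KrizLi2019.thm33_rank_twist)
    (hBF : bsdTriple_of_hasCM_of_L_one_ne_zero) (hmod : hasEntireLFunction_rat)
    (hcm : W.HasCM) (hrk : 1 ≤ W.mordellWeilRank) (h2 : ∀ Q : W.toAffine.Point, 2 • Q = 0 → Q = 0)
    (K : Type) [Field K] [NumberField K] (hK : IsImaginaryQuadratic K)
    (hH : SatisfiesHeegnerHypothesis (W.conductorNorm ℤ) K)
    (Dt : ModularParametrizationData W (W.conductorNorm ℤ))
    (H : HeegnerDatum (W.conductorNorm ℤ) (NumberField.discr K)) (ι : K →+* ℂ)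
    (P : (W.baseChange K).toAffine.Point)
    (hP : WeierstrassCurve.Affine.Point.map ι.toRatAlgHom P = heegnerPointComplex Dt H)
    (j : K →ₐ[ℚ] ℚ_[2]) (hstar : KrizLi2019.AssumptionStar W Dt K P j)
    {d : ℤ} (hd : KrizLi2019.InN W K d) (hsign : Int.sign d * jacobiSym (W.conductorNorm ℤ) d.natAbs = 1)
    (W₁ W₂ : WeierstrassCurve ℚ) [W₁.IsElliptic] [W₁.IsGloballyMinimal] [W₂.IsElliptic] [W₂.IsGloballyMinimal]
    (hW₁ : ∃ C : VariableChange ℚ, C • W.quadraticTwist (d : ℚ) = W₁)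
    (hW₂ : ∃ C : VariableChange ℚ, C • W.quadraticTwist ((d * NumberField.discr K : ℤ) : ℚ) = W₂) :
    W₁.analyticRank = 1 ∧ W₂.analyticRank = 0 := by
  obtain ⟨-, -, hor, hiff⟩ := h33 W h2 K hK hH Dt H ι P hP j hstar d hd W₁ W₂
    (exists_smul_eq_comm.2 hW₁) (exists_smul_eq_comm.2 hW₂)
  have h1 : W₁.analyticRank = 1 := by
    rw [← analyticRank_eq_one_of_assumptionStar W h33 hBF hmod hcm hrk h2 K hK hH Dt H ι P hP j hstar]
    exact hiff.2 hsign
  rcases hor with ⟨-, h0⟩ | ⟨h0, -⟩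
  · exact ⟨h1, h0⟩
  · omega

/-! ## §2 The `ℚ`-isogeny classes of the family (Cassels' invariance and GZK, both in 𝔅_inert) -/

/-- **`BSD(W', 2)` for every globally minimal `W'` `ℚ`-ISOGENOUS to a Kriz–Li twist of a small-conductor CM
base**: the twist theorem on a globally minimal model, then Cassels' isogeny invariance (`hCassels`, tree
`Wuthrich2014.bsdp_of_isIsogenous`; `Ш` finite by GZK `hGZK` in analytic rank `≤ 1`, `L^{(r)}(1) ≠ 0` by
modularity). [cite: KrizLi2019, Thm. 5.1 (2) and Thm. 4.3] [cite: MilneADT2006, Thm. I.7.3] [cite: Miller2011LMS, Def. 1.1] -/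
theorem bsdp_two_of_isIsogenous_twist_of_krizLi_cmBase (hKL : KrizLi2019.thm112_bsdTwo_twist)
    (h33 : KrizLi2019.thm33_rank_twist) (hS31 : bsdTriple_of_analyticRank_le_one_of_conductor_lt)
    (hBF : bsdTriple_of_hasCM_of_L_one_ne_zero) (hmod : hasEntireLFunction_rat)
    (hGZK : rank_eq_analyticRank_of_analyticRank_le_one) (hCassels : bsdRHS_eq_of_isIsogenous)
    (hcm : W.HasCM) (hN : W.conductorNorm ℤ < 5000) (hrk : 1 ≤ W.mordellWeilRank)
    (h2 : ∀ Q : W.toAffine.Point, 2 • Q = 0 → Q = 0)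
    (K : Type) [Field K] [NumberField K] (hK : IsImaginaryQuadratic K)
    (hH : SatisfiesHeegnerHypothesis (W.conductorNorm ℤ) K)
    (Dt : ModularParametrizationData W (W.conductorNorm ℤ))
    (H : HeegnerDatum (W.conductorNorm ℤ) (NumberField.discr K)) (ι : K →+* ℂ)
    (P : (W.baseChange K).toAffine.Point)
    (hP : WeierstrassCurve.Affine.Point.map ι.toRatAlgHom P = heegnerPointComplex Dt H)
    (j : K →ₐ[ℚ] ℚ_[2]) (hstar : KrizLi2019.AssumptionStar W Dt K P j)
    (hloc : (haveI : Fact (2 : ℕ).Prime := ⟨Nat.prime_two⟩;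
      Odd ((W.baseChange ℚ_[2]).localTamagawaNumber ℤ_[2]) ∧
        (¬ W.HasGoodReductionAtPrime 2 → ¬ W.HasMultiplicativeReductionAtPrime 2 → Odd Dt.c)))
    {d : ℤ} (hd : KrizLi2019.InN W K d) (hsign : Int.sign d * jacobiSym (W.conductorNorm ℤ) d.natAbs = 1)
    (W' : WeierstrassCurve ℚ) [W'.IsElliptic] [W'.IsGloballyMinimal]
    (hiso : IsIsogenous W' (W.quadraticTwist (d : ℚ)) ∨
      IsIsogenous W' (W.quadraticTwist ((d * NumberField.discr K : ℤ) : ℚ))) : BSDp W' 2 := by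
  have hD : (NumberField.discr K : ℚ) ≠ 0 := by exact_mod_cast NumberField.discr_ne_zero K
  have hd0 : (d : ℚ) ≠ 0 := cast_ne_zero_of_inN W hd
  have hdK : ((d * NumberField.discr K : ℤ) : ℚ) ≠ 0 := by push_cast; exact mul_ne_zero hd0 hD
  haveI := W.isElliptic_quadraticTwist hd0
  haveI := W.isElliptic_quadraticTwist hdK
  obtain ⟨W₁, _, _, C₁, hC₁⟩ := exists_globallyMinimal_twist W hd0
  obtain ⟨W₂, _, _, C₂, hC₂⟩ := exists_globallyMinimal_twist W hdK
  obtain ⟨hr1, hr2⟩ := analyticRank_of_twist_of_krizLi_cmBase W h33 hBF hmod hcm hrk h2 K hK hH Dt H ι P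
    hP j hstar hd hsign W₁ W₂ ⟨C₁, hC₁⟩ ⟨C₂, hC₂⟩
  rcases hiso with hiso | hiso
  · have hiso' : IsIsogenous W' W₁ := hiso.trans' (by rw [← hC₁]; exact isIsogenous_smul _ C₁)
    have hbsd := bsdp_two_of_twist_of_krizLi_cmBase W hKL h33 hS31 hBF hmod hcm hN hrk h2 K hK hH Dt H ι P
      hP j hstar hloc hd hsign W₁ (Or.inl ⟨C₁, hC₁⟩)
    exact Wuthrich2014.bsdp_of_isIsogenous hCassels hiso' (hGZK W₁ hr1.le).2
      (W₁.leadingLCoeff_ne_zero_holds (hmod W₁)) hbsd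
  · have hiso' : IsIsogenous W' W₂ := hiso.trans' (by rw [← hC₂]; exact isIsogenous_smul _ C₂)
    have hbsd := bsdp_two_of_twist_of_krizLi_cmBase W hKL h33 hS31 hBF hmod hcm hN hrk h2 K hK hH Dt H ι P
      hP j hstar hloc hd hsign W₂ (Or.inr ⟨C₂, hC₂⟩)
    exact Wuthrich2014.bsdp_of_isIsogenous hCassels hiso' (hGZK W₂ (by rw [hr2]; exact zero_le_one)).2
      (W₂.leadingLCoeff_ne_zero_holds (hmod W₂)) hbsd

omit [W.IsGloballyMinimal] [NeZero (W.conductorNorm ℤ)] in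
/-- **Placement along the isogeny classes**: CM is a twist invariant and an isogeny invariant, so every
curve `ℚ`-isogenous to a twist of a CM base has CM. [cite: SilvermanAEC2009, Cor. III.9.4 and X.5.4] -/
theorem hasCM_of_isIsogenous_twist_of_hasCM (hcm : W.HasCM) {e : ℚ} (he : e ≠ 0)
    (W' : WeierstrassCurve ℚ) [W'.IsElliptic] (hiso : IsIsogenous W' (W.quadraticTwist e)) : W'.HasCM := by
  haveI := W.isElliptic_quadraticTwist he
  have hT : (W.quadraticTwist e).HasCM :=
    hasCM_of_smul_twist_of_hasCM hcm he ⟨1, one_smul _ _⟩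
  exact X12.hasCM_of_isIsogenous hiso.symm_of_charZero hT

end Base

end Summit.BirchSwinnertonDyer.Rank1Residual.P2

end
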